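import Literature.AnabelianGeometry.EtaleTheta.Discharge.Sec4CyclotomicLawBaseFieldHull
import HarnessLib

/-!
# [EtTh] Def. 4.1 (iv) / [FrdII] Rmk. 2.2.1 AT THE BASE-FIELD-THEORETIC HULL: every Galois-based object is dominated by a pull-back
# morphism from a `μ_N`-SATURATED Galois-based object (the refinement law `hE`, trivial `(N,H)`-slot) — PROOF-ONLY

S. Mochizuki, *The étale theta function …*, Publ. RIMS **45** (2009) [MochizukiEtTh2009], Def. 4.1 (iv) p.313 (PDF p.87) («`μ_N`-saturated»),
proof of Prop. 4.2 (iii) p.315 (PDF p.89) («after passing to an appropriate tempered covering … `μ_N`-saturated»); [FrdII] Def. 2.1 (i), Rmk. 2.2.1.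
[cite: MochizukiEtTh2009, Def 4.1 (iv) p.313 (PDF p.87); Prop 4.2 (iii) p.315 (PDF p.89)]

abc-iut cell, layer L2, seat abc-iut-L2-d3 (gen 10), row R1112 junction (c).  PROOF-ONLY (0 definitions, no instance, no notation, no sorry), for ANY
tempered `Γ` and continuous `a : Γ → G_{ℚ_p}` with open images (no arithmetic surface group `X` needed): abc-iut-w6-d037's argument of
`Prop42Sub.refinementLaw_mkOfModelCanonical_of_cyclotomicLaw` (`Sec4MuSaturatedOfRatFnTorsion.lean`) run at the hull on this lineage's
`BsFldHull.cyclotomicLaw` (p511174): over the cyclotomic cover `b : Y′ → A′^bs` the [FrdI] Thm. 5.2 (i) morphism `(1, b, 0, 1) : (Y′, b^*[A′]) → A′` is a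
pull-back morphism (`ModelFrobenioid.isPullbackMorphism_of`) from a `μ_N`-saturated object (`isMuSaturated_iff_ratFnTorsion`).  This is the `hE`
binder (GAP G-w4d044-2) of the Prop. 4.2 (iii)/(iv) closers and the `hEdiv` binder of abc-iut-w6-d053's §5 root-family closers, AT THE HULL, with the
trivial `(N,H)`-slot.
HONEST FRAMING: classical cyclotomic theory at a carrier with genuine `ℚ̄_p` constants; nothing of [EtTh] beyond the typed statements is asserted;
nothing here bears on [IUTchIII] Cor. 3.12; no side taken; typed ≠ proved elsewhere.
-/

noncomputable section

namespace Literature.AnabelianGeometry.EtaleTheta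

open CategoryTheory Opposite Literature.AlgebraicGeometry.Frobenioids Literature.AnabelianGeometry.SemiGraphs

namespace BsFldHull

variable (p : ℕ) [Fact p.Prime] {Γ : Type} [Group Γ] [TopologicalSpace Γ] (a : Γ →* GQp p)
  (ha : ∀ U : OpenSubgroup Γ, IsOpen ((U.toSubgroup.map a : Subgroup (GQp p)) : Set (GQp p))) [IsTopologicalGroup Γ]
  (hΓ : IsTempered Γ) (R S : ((ConnectedPart (BTemp Γ))ᵒᵖ ⥤ CommMonCat.{0}) → Prop)

/-- **`B` of the hull is group-like** ([FrdI] Thm. 5.2 (ii) hypothesis; every function of `B₀(Γ/U) = K_U^×` is a unit).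
[cite: MochizukiEtTh2009, Def 3.6 p.303 (PDF p.77)] -/
theorem isGroupLike_ratFnFunctor : Objectwise (fun M _ => IsGroupLike M) (temperedFrobenioid p a ha hΓ R S).ratFnFunctor :=
  (temperedFrobenioid p a ha hΓ R S).isGroupLike_ratFnFunctor
    (RealifiedDivisorMonoids.ofRlfZWeak (DivisorMonoids.bsFldHull p a ha) (hpf p a ha)).isUnit_BΛ

/-- **The refinement law `hE` HOLDS at the hull (trivial `(N,H)`-slot)**: every object `A′` of the hull with Galois base is the target of a
pull-back morphism `ψ : A″ → A′` with `A″` Galois-based and `μ_N`-SATURATED — `A″ := (Y′, b^*[A′])` over the cyclotomic cover `b : Y′ → A′^bs` of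
`cyclotomicLaw` («`K_N ∋ ζ_N`»), `ψ := (1, b, 0, 1)`.  [cite: MochizukiEtTh2009, Def 4.1 (iv) p.313 (PDF p.87); Prop 4.2 (iii) p.315 (PDF p.89)] -/
theorem exists_isMuSaturated_pullback (hcont : Continuous a) (N : ℕ+) (A' : (temperedFrobenioid p a ha hΓ R S).category)
    (hA' : IsGaloisObj A'.base.obj) :
    ∃ (A'' : (temperedFrobenioid p a ha hΓ R S).category) (ψ : A'' ⟶ A'),
      PreFrobenioid.IsPullbackMorphism (temperedFrobenioid p a ha hΓ R S).toElem ψ ∧ IsGaloisObj A''.base.obj ∧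
        (temperedFrobenioid p a ha hΓ R S).IsMuSaturated A'' N := by
  obtain ⟨Y', hY', b, hcyc⟩ := cyclotomicLaw p a ha hΓ R S hcont N A'.base hA'
  have hΦd := (temperedFrobenioid p a ha hΓ R S).isDivisorial_divisorMonoid
  let W : (temperedFrobenioid p a ha hΓ R S).category := ⟨Y', pullGp (temperedFrobenioid p a ha hΓ R S).divisorMonoid b A'.cls⟩
  let δ : W ⟶ A' := ModelFrobenioid.mkHom W A' 1 b 1 1 (by
    rw [PNat.one_coe, pow_one, map_one, mul_one, map_one, mul_one])
  exact ⟨W, δ, ModelFrobenioid.isPullbackMorphism_of hΦd (isGroupLike_ratFnFunctor p a ha hΓ R S) rfl rfl, hY',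
    ((temperedFrobenioid p a ha hΓ R S).isMuSaturated_iff_ratFnTorsion W (hΦd Y') N).mpr hcyc⟩

/-- **`hEdiv` at the hull** (abc-iut-w6-d053's binder shape, trivial `(N,H)`-slot): the `μ_M`-saturated pull-back cover, with the vacuous
`(N,H)`-clause for every `N ∣ M`.  [cite: MochizukiEtTh2009, Def 4.1 (iv) p.313 (PDF p.87); Prop 4.2 (iii) p.315 (PDF p.89)] -/
theorem exists_isMuSaturated_pullback_dvd (hcont : Continuous a) (M : ℕ+) (A' : (temperedFrobenioid p a ha hΓ R S).category)
    (hA' : IsGaloisObj A'.base.obj) :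
    ∃ (A'' : (temperedFrobenioid p a ha hΓ R S).category) (ψ : A'' ⟶ A'),
      PreFrobenioid.IsPullbackMorphism (temperedFrobenioid p a ha hΓ R S).toElem ψ ∧ IsGaloisObj A''.base.obj ∧
        (temperedFrobenioid p a ha hΓ R S).IsMuSaturated A'' M ∧ ∀ N : ℕ+, (N : ℕ) ∣ (M : ℕ) → True := by
  obtain ⟨A'', ψ, h1, h2, h3⟩ := exists_isMuSaturated_pullback p a ha hΓ R S hcont M A' hA'
  exact ⟨A'', ψ, h1, h2, h3, fun _ _ => trivial⟩

end BsFldHull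

end Literature.AnabelianGeometry.EtaleTheta

end
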